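import Mathlib
import Summits.Ventures.DiscreteObjects.Mahler.SubLehmerDegree58
import Summits.KontsevichZagierPeriods.KontsevichZagierPeriods.Theorems.KzOnePeriodsLemmaN

/-!
# Structure of a sub-Lehmer integer polynomial: cyclotomic cofactor times an irreducible core
(venture `DiscreteObjects`, target L)

Cell `pub-namedobj`, seat `pub-namedobj-mahler` (gen 6). Framing: lottery ticket; floor = certified
bounds/negative ranges.

Degree-free form of `SubLehmerDegree56/57/58`.  Conditional on the named facts
`SubLehmerDegreeBound` ([MRW08, Thm 1.1]: `1 < M(P) < M(L) ⇒ deg P ≥ 56`) and, where stated,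
`NonreciprocalMahlerBound` (Smyth), a sub-Lehmer integer polynomial `P` of degree `< 112` is

  `P = ± x^a · Φ_{m₁} ⋯ Φ_{m_r} · Q`

with `Q` IRREDUCIBLE, sub-Lehmer with `M(Q) = M(P)`, reciprocal (`Q.reverse = Q`), of EVEN degree
`≥ 56`, with nonzero constant term and no cyclotomic factor (`subLehmer_structure`).  Ingredients:

* `kronecker_form` — Kronecker's theorem in product form: an integer polynomial of Mahler measure `1`
  is `± x^a · ∏ Φ_{m_i}` (from Mathlib's `Polynomial.cyclotomic_dvd_of_mahlerMeasure_eq_one`, by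
  induction on the degree), with `deg = a + Σ φ(m_i)` (`natDegree_signed_cyclotomic_prod`);
* `subLehmer_core` — extraction of the irreducible core (induction on the degree, using
  `measure_one_of_mul` and `natDegree_le_of_dvd_of_measure_one` of `SubLehmerDegree57`);
* `core_coeff_zero_ne_zero`, `core_not_cyclotomic_dvd`, `core_reverse_eq`, `core_even_natDegree` —
  properties of an irreducible sub-Lehmer polynomial (the last two use Smyth's theorem);
* the elementary fact `φ(m) ≤ 4 ⇒ m ∈ {1,2,3,4,5,6,8,10,12}` is REUSED from the tree
  (`Summit.KontsevichZagierPeriods.KzOnePeriods.LemmaN.totient_le_four`, pure Mathlib arithmetic);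
* `subLehmer_degree_le_60_structure` — the census scope up to degree `60`: `deg Q ∈ {56, 58, 60}` and
  the cofactor is `± x^a ∏ Φ_{m_i}` with `a + Σ φ(m_i) = deg P − deg Q ≤ 4`, every
  `m_i ∈ {1,2,3,4,5,6,8,10,12}` — i.e. degrees `59/60` of the height-1 census are the irreducible
  slices `CORES(56/58/60)` plus finitely many explicit cyclotomic "offset" families (EFFICIENCY-L6c §10),
  exactly as degree `57/58` were (`subLehmer_degree57_structure`, `subLehmer_degree58_structure`).

Nothing here bounds a Mahler measure; everything is an elementary consequence of the two named facts,
Mathlib's Kronecker theorem and the kernel enclosure `1.17628 < M(L) < 1.17629`.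
-/

namespace Summit.Ventures.DiscreteObjects.Mahler

open Polynomial Literature.NumberTheory.MahlerMeasure

/-! ### Kronecker's theorem in product form -/

/-- A product of integer cyclotomic polynomials is monic. -/
theorem monic_cyclotomic_prod (s : Multiset ℕ) : ((s.map fun m => cyclotomic m ℤ).prod).Monic :=
  monic_multiset_prod_of_monic s (fun m => cyclotomic m ℤ) fun m _ => cyclotomic.monic m ℤ

/-- Degree of the cyclotomic part: `Σ φ(m_i)`. -/
theorem natDegree_cyclotomic_prod (s : Multiset ℕ) :
    ((s.map fun m => cyclotomic m ℤ).prod).natDegree = (s.map Nat.totient).sum := by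
  rw [natDegree_multiset_prod_of_monic _ (fun f hf => ?_)]
  · rw [Multiset.map_map]
    congr 1
    apply Multiset.map_congr rfl
    intro m _
    simp [natDegree_cyclotomic]
  · obtain ⟨m, _, rfl⟩ := Multiset.mem_map.mp hf
    exact cyclotomic.monic m ℤ

/-- Degree of `± x^a · ∏ Φ_{m_i}`: `a + Σ φ(m_i)`. -/
theorem natDegree_signed_cyclotomic_prod {u : ℤ} (hu : u = 1 ∨ u = -1) (a : ℕ) (s : Multiset ℕ) :
    (C u * X ^ a * (s.map fun m => cyclotomic m ℤ).prod).natDegree = a + (s.map Nat.totient).sum := by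
  have hu0 : (C u : ℤ[X]) ≠ 0 := by
    rcases hu with rfl | rfl <;> simp
  have hXa : (X ^ a : ℤ[X]) ≠ 0 := pow_ne_zero a X_ne_zero
  have hprod : ((s.map fun m => cyclotomic m ℤ).prod) ≠ 0 := (monic_cyclotomic_prod s).ne_zero
  rw [natDegree_mul (mul_ne_zero hu0 hXa) hprod, natDegree_mul hu0 hXa, natDegree_C, zero_add,
    natDegree_pow, natDegree_X, mul_one, natDegree_cyclotomic_prod]

/-- The Mahler measure of `± x^a · ∏ Φ_{m_i}` is `1` (converse direction of Kronecker's theorem). -/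
theorem intMahlerMeasure_signed_cyclotomic_prod {u : ℤ} (hu : u = 1 ∨ u = -1) (a : ℕ) (s : Multiset ℕ) :
    intMahlerMeasure (C u * X ^ a * (s.map fun m => cyclotomic m ℤ).prod) = 1 := by
  rw [intMahlerMeasure_mul, intMahlerMeasure_mul, intMahlerMeasure_C]
  have h1 : |(u : ℝ)| = 1 := by rcases hu with rfl | rfl <;> simp
  have h2 : intMahlerMeasure (X ^ a : ℤ[X]) = 1 := by
    induction a with
    | zero => simpa using intMahlerMeasure_C 1
    | succ n ih => rw [pow_succ, intMahlerMeasure_mul, ih, intMahlerMeasure_X, one_mul]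
  have h3 : ∀ t : Multiset ℕ, intMahlerMeasure ((t.map fun m => cyclotomic m ℤ).prod) = 1 := by
    intro t
    induction t using Multiset.induction_on with
    | empty => simpa using intMahlerMeasure_C 1
    | cons m t ih =>
      rw [Multiset.map_cons, Multiset.prod_cons, intMahlerMeasure_mul, ih, intMahlerMeasure_cyclotomic,
        one_mul]
  rw [h1, h2, h3, one_mul, one_mul]

/-- **Kronecker's theorem, product form.** An integer polynomial of Mahler measure `1` is
`± x^a · Φ_{m₁} ⋯ Φ_{m_r}` for some `a ≥ 0` and positive integers `m_i` (Mathlib's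
`Polynomial.cyclotomic_dvd_of_mahlerMeasure_eq_one`, iterated by induction on the degree). -/
theorem kronecker_form {P : ℤ[X]} (hM : intMahlerMeasure P = 1) :
    ∃ (u : ℤ) (a : ℕ) (s : Multiset ℕ), (u = 1 ∨ u = -1) ∧ (∀ m ∈ s, 0 < m) ∧
      P = C u * X ^ a * (s.map fun m => cyclotomic m ℤ).prod := by
  -- induction on the degree
  suffices key : ∀ d : ℕ, ∀ P : ℤ[X], P.natDegree = d → intMahlerMeasure P = 1 →
      ∃ (u : ℤ) (a : ℕ) (s : Multiset ℕ), (u = 1 ∨ u = -1) ∧ (∀ m ∈ s, 0 < m) ∧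
        P = C u * X ^ a * (s.map fun m => cyclotomic m ℤ).prod from
    key P.natDegree P rfl hM
  intro d
  induction d using Nat.strong_induction_on with
  | _ d ih =>
    intro P hd hM
    have hP0 : P ≠ 0 := by
      intro h0; rw [h0] at hM; unfold intMahlerMeasure at hM
      simp only [Polynomial.map_zero, mahlerMeasure_zero] at hM; exact zero_ne_one hM
    by_cases hd0 : d = 0
    · -- constant polynomial: |c| = 1
      subst hd0
      have hPc : P = C (P.coeff 0) := eq_C_of_natDegree_eq_zero hd
      rw [hPc, intMahlerMeasure_C] at hM
      refine ⟨P.coeff 0, 0, 0, ?_, fun m hm => absurd hm (Multiset.notMem_zero m), ?_⟩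
      · have h1 : |P.coeff 0| = 1 := by exact_mod_cast hM
        rcases abs_eq (zero_le_one' ℤ) |>.mp h1 with h | h
        · exact Or.inl h
        · exact Or.inr h
      · simpa using hPc
    by_cases hX : X ∣ P
    · -- peel off a factor x
      obtain ⟨R, hR⟩ := hX
      have hR0 : R ≠ 0 := by rintro rfl; rw [mul_zero] at hR; exact hP0 hR
      have hMR : intMahlerMeasure R = 1 := by
        rw [hR, intMahlerMeasure_mul, intMahlerMeasure_X, one_mul] at hM; exact hM
      have hdR : R.natDegree < d := by
        rw [← hd, hR, natDegree_mul X_ne_zero hR0, natDegree_X]; omega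
      obtain ⟨u, a, s, hu, hs, hRf⟩ := ih R.natDegree hdR R rfl hMR
      refine ⟨u, a + 1, s, hu, hs, ?_⟩
      rw [hR, hRf]; ring
    · -- peel off a cyclotomic factor (Kronecker)
      have hdeg : P.degree ≠ 0 := by
        rw [degree_eq_natDegree hP0]; exact_mod_cast (hd ▸ hd0 : P.natDegree ≠ 0)
      obtain ⟨n, hn, hdvd⟩ := cyclotomic_dvd_of_mahlerMeasure_eq_one hM hX hdeg
      obtain ⟨R, hR⟩ := hdvd
      have hc0 : cyclotomic n ℤ ≠ 0 := cyclotomic_ne_zero n ℤ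
      have hR0 : R ≠ 0 := by rintro rfl; rw [mul_zero] at hR; exact hP0 hR
      have hMR : intMahlerMeasure R = 1 := by
        rw [hR, intMahlerMeasure_mul, intMahlerMeasure_cyclotomic, one_mul] at hM; exact hM
      have hdR : R.natDegree < d := by
        rw [← hd, hR, natDegree_mul hc0 hR0, natDegree_cyclotomic]
        have := Nat.totient_pos.mpr hn
        omega
      obtain ⟨u, a, s, hu, hs, hRf⟩ := ih R.natDegree hdR R rfl hMR
      refine ⟨u, a, n ::ₘ s, hu, fun m hm => ?_, ?_⟩
      · rcases Multiset.mem_cons.mp hm with rfl | hm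
        · exact hn
        · exact hs m hm
      · rw [hR, hRf, Multiset.map_cons, Multiset.prod_cons]; ring

/-! ### The irreducible core of a sub-Lehmer polynomial -/

/-- In an irreducible integer polynomial, a non-unit divisor of Mahler measure `1` forces Mahler
measure `1` (the cofactor is a unit `± 1`). -/
theorem measure_eq_one_of_irreducible_of_dvd {Q D : ℤ[X]} (hirr : Irreducible Q) (hD : D ∣ Q)
    (hDu : ¬ IsUnit D) (hMD : intMahlerMeasure D = 1) : intMahlerMeasure Q = 1 := by
  obtain ⟨R, hR⟩ := hD
  rcases hirr.isUnit_or_isUnit hR with hu | hu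
  · exact absurd hu hDu
  · obtain ⟨r, hr, hrR⟩ := Polynomial.isUnit_iff.mp hu
    rw [hR, ← hrR, intMahlerMeasure_mul, hMD, intMahlerMeasure_C, one_mul]
    rcases Int.isUnit_iff.mp hr with h | h <;> simp [h]

/-- An irreducible sub-Lehmer polynomial has nonzero constant term (`x ∤ Q`). -/
theorem core_coeff_zero_ne_zero {Q : ℤ[X]} (hirr : Irreducible Q) (hQ : SubLehmer Q) : Q.coeff 0 ≠ 0 := by
  intro h0
  have h1 := measure_eq_one_of_irreducible_of_dvd hirr (X_dvd_iff.mpr h0) Polynomial.not_isUnit_X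
    intMahlerMeasure_X
  linarith [hQ.1]

/-- An irreducible sub-Lehmer polynomial has no cyclotomic factor. -/
theorem core_not_cyclotomic_dvd {Q : ℤ[X]} (hirr : Irreducible Q) (hQ : SubLehmer Q) {n : ℕ}
    (hn : 0 < n) : ¬ cyclotomic n ℤ ∣ Q := by
  intro hdvd
  have hnu : ¬ IsUnit (cyclotomic n ℤ) := fun hu => by
    have h0 := natDegree_eq_zero_of_isUnit hu
    rw [natDegree_cyclotomic] at h0
    have := Nat.totient_pos.mpr hn
    omega
  have h1 := measure_eq_one_of_irreducible_of_dvd hirr hdvd hnu (intMahlerMeasure_cyclotomic n)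
  linarith [hQ.1]

/-- An irreducible sub-Lehmer polynomial is reciprocal (`Q.reverse = Q`), CONDITIONAL on Smyth's
theorem: a nonreciprocal one would have `M ≥ M(x³-x-1) > 1.32`, and an antireciprocal one
(`Q.reverse = -Q`) vanishes at `1`, i.e. is divisible by `Φ₁ = x - 1`. -/
theorem core_reverse_eq (hS : NonreciprocalMahlerBound) {Q : ℤ[X]} (hirr : Irreducible Q)
    (hQ : SubLehmer Q) : Q.reverse = Q := by
  have hc0 := core_coeff_zero_ne_zero hirr hQ
  have hLup : intMahlerMeasure lehmerPoly < 117629 / 100000 := lehmer_measure_upper_bound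
  by_contra hne
  by_cases hanti : Q.reverse = -Q
  · have h1 : Q.eval 1 = 0 := eval_one_eq_zero_of_reverse_eq_neg hanti
    have hdvd : cyclotomic 1 ℤ ∣ Q := by
      rw [cyclotomic_one]; exact dvd_iff_isRoot.mpr h1
    exact core_not_cyclotomic_dvd hirr hQ one_pos hdvd
  · have hsm := hS Q hirr hc0 hne hanti
    change intMahlerMeasure (X ^ 3 - X - 1 : ℤ[X]) ≤ intMahlerMeasure Q at hsm
    have h1 := smythPoly_measure_lower_bound
    linarith [hQ.2]

/-- An irreducible sub-Lehmer polynomial has even degree, CONDITIONAL on Smyth's theorem: it is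
reciprocal, and a reciprocal polynomial of odd degree vanishes at `-1` (is divisible by `Φ₂ = x + 1`). -/
theorem core_even_natDegree (hS : NonreciprocalMahlerBound) {Q : ℤ[X]} (hirr : Irreducible Q)
    (hQ : SubLehmer Q) : Even Q.natDegree := by
  by_contra hodd
  rw [Nat.not_even_iff_odd] at hodd
  have hrev := core_reverse_eq hS hirr hQ
  have h1 : Q.eval (-1) = 0 := eval_neg_one_eq_zero_of_reverse_eq hrev hodd
  have hdvd : cyclotomic 2 ℤ ∣ Q := by
    rw [cyclotomic_two]
    have : (X + 1 : ℤ[X]) = X - C (-1) := by simp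
    rw [this]; exact dvd_iff_isRoot.mpr h1
  exact core_not_cyclotomic_dvd hirr hQ two_pos hdvd

/-- **Core extraction** (conditional on [MRW08, Thm 1.1]): a sub-Lehmer integer polynomial of degree
`< 112` is `C · Q` with `M(C) = 1` and `Q` IRREDUCIBLE, sub-Lehmer, `M(Q) = M(P)`, `deg Q ≥ 56`.
(Induction on the degree: in a nontrivial factorisation one factor has measure `1` by
`measure_one_of_mul`; the other is sub-Lehmer of smaller degree.  The bound `112 = 2·56` is what rules
out two sub-Lehmer factors; without it the conclusion would need Lehmer's conjecture.) -/
theorem subLehmer_core (h : SubLehmerDegreeBound) {P : ℤ[X]} (hP : SubLehmer P) (hdeg : P.natDegree < 112) :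
    ∃ C Q : ℤ[X], P = C * Q ∧ intMahlerMeasure C = 1 ∧ Irreducible Q ∧ SubLehmer Q ∧
      intMahlerMeasure Q = intMahlerMeasure P ∧ 56 ≤ Q.natDegree ∧
      C.natDegree + Q.natDegree = P.natDegree := by
  suffices key : ∀ d : ℕ, ∀ P : ℤ[X], P.natDegree = d → SubLehmer P → d < 112 →
      ∃ C Q : ℤ[X], P = C * Q ∧ intMahlerMeasure C = 1 ∧ Irreducible Q ∧ SubLehmer Q ∧
        intMahlerMeasure Q = intMahlerMeasure P ∧ 56 ≤ Q.natDegree ∧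
        C.natDegree + Q.natDegree = P.natDegree from
    key P.natDegree P rfl hP hdeg
  intro d
  induction d using Nat.strong_induction_on with
  | _ d ih =>
    intro P hd hP hd112
    have hP0 : P ≠ 0 := by
      intro h0; have := hP.1; rw [h0] at this; unfold intMahlerMeasure at this
      simp only [Polynomial.map_zero, mahlerMeasure_zero] at this; linarith
    have h56 : 56 ≤ P.natDegree := natDegree_ge_of_subLehmer h hP
    by_cases hirr : Irreducible P
    · refine ⟨1, P, (one_mul P).symm, ?_, hirr, hP, rfl, h56, by simp⟩
      simpa using intMahlerMeasure_C 1
    -- a nontrivial factorisation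
    have hnu : ¬ IsUnit P := fun hu => by have := natDegree_eq_zero_of_isUnit hu; omega
    obtain ⟨a, b, hab, hna, hnb⟩ : ∃ a b : ℤ[X], P = a * b ∧ ¬ IsUnit a ∧ ¬ IsUnit b := by
      by_contra hnone
      push Not at hnone
      exact hirr ⟨hnu, fun a b hab => by
        by_cases ha : IsUnit a
        · exact Or.inl ha
        · exact Or.inr (hnone a b hab ha)⟩
    have ha0 : a ≠ 0 := by intro h0; apply hP0; rw [hab, h0, zero_mul]
    have hb0 : b ≠ 0 := by intro h0; apply hP0; rw [hab, h0, mul_zero]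
    -- arrange that b is the measure-1 factor
    wlog hMb : intMahlerMeasure b = 1 generalizing a b
    · have hor := measure_one_of_mul h hP hab (by omega)
      have hMa : intMahlerMeasure a = 1 := by tauto
      exact this b a (by rw [hab, mul_comm]) hnb hna hb0 ha0 hMa
    -- b has positive degree (a measure-1 constant is a unit)
    have hbd1 : 1 ≤ b.natDegree := by
      by_contra hlt
      have h0 : b.natDegree = 0 := by omega
      rw [eq_C_of_natDegree_eq_zero h0] at hMb hnb
      rw [intMahlerMeasure_C] at hMb
      apply hnb
      apply isUnit_C.mpr
      rw [Int.isUnit_iff_abs_eq]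
      exact_mod_cast hMb
    have hsum : a.natDegree + b.natDegree = d := by rw [← hd, hab, natDegree_mul ha0 hb0]
    have hMa : intMahlerMeasure a = intMahlerMeasure P := by
      rw [hab, intMahlerMeasure_mul, hMb, mul_one]
    have haP : SubLehmer a := by unfold SubLehmer at hP ⊢; rw [hMa]; exact hP
    obtain ⟨C', Q, haf, hMC', hQirr, hQ, hMQ, hQ56, hdegs⟩ :=
      ih a.natDegree (by omega) a rfl haP (by omega)
    refine ⟨b * C', Q, by rw [hab, haf]; ring, by rw [intMahlerMeasure_mul, hMb, hMC', one_mul], hQirr, hQ,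
      by rw [hMQ, hMa], hQ56, ?_⟩
    have hC'0 : C' ≠ 0 := by rintro rfl; rw [zero_mul] at haf; exact ha0 haf
    rw [natDegree_mul hb0 hC'0, hab, natDegree_mul ha0 hb0]
    omega

/-- **Structure theorem** (conditional on [MRW08, Thm 1.1] and Smyth's theorem): a sub-Lehmer integer
polynomial of degree `< 112` is `± x^a · Φ_{m₁} ⋯ Φ_{m_r} · Q` with `Q` irreducible, sub-Lehmer,
`M(Q) = M(P)`, reciprocal, of even degree `≥ 56`, with nonzero constant term and no cyclotomic factor,
and `a + Σ φ(m_i) + deg Q = deg P`. -/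
theorem subLehmer_structure (h : SubLehmerDegreeBound) (hS : NonreciprocalMahlerBound) {P : ℤ[X]}
    (hP : SubLehmer P) (hdeg : P.natDegree < 112) :
    ∃ (u : ℤ) (a : ℕ) (s : Multiset ℕ) (Q : ℤ[X]), (u = 1 ∨ u = -1) ∧ (∀ m ∈ s, 0 < m) ∧
      P = C u * X ^ a * (s.map fun m => cyclotomic m ℤ).prod * Q ∧ Irreducible Q ∧ SubLehmer Q ∧
      intMahlerMeasure Q = intMahlerMeasure P ∧ Q.reverse = Q ∧ Even Q.natDegree ∧ 56 ≤ Q.natDegree ∧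
      Q.coeff 0 ≠ 0 ∧ (∀ n : ℕ, 0 < n → ¬ cyclotomic n ℤ ∣ Q) ∧
      a + (s.map Nat.totient).sum + Q.natDegree = P.natDegree := by
  obtain ⟨C, Q, hPCQ, hMC, hQirr, hQ, hMQ, hQ56, hdegs⟩ := subLehmer_core h hP hdeg
  obtain ⟨u, a, s, hu, hs, hCf⟩ := kronecker_form hMC
  refine ⟨u, a, s, Q, hu, hs, by rw [hPCQ, hCf], hQirr, hQ, hMQ, core_reverse_eq hS hQirr hQ,
    core_even_natDegree hS hQirr hQ, hQ56, core_coeff_zero_ne_zero hQirr hQ,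
    fun n hn => core_not_cyclotomic_dvd hQirr hQ hn, ?_⟩
  rw [← hdegs, hCf, natDegree_signed_cyclotomic_prod hu]

/-! ### The census scope up to degree 60 -/

/-- **Census scope up to degree 60** (conditional on [MRW08, Thm 1.1] and Smyth's theorem): a
sub-Lehmer integer polynomial of degree `≤ 60` is `± x^a · Φ_{m₁} ⋯ Φ_{m_r} · Q` with `Q` irreducible,
sub-Lehmer, `M(Q) = M(P)`, reciprocal, cyclotomic-free with `Q(0) ≠ 0`, of degree `56`, `58` or `60`,
and a cyclotomic cofactor of degree `a + Σ φ(m_i) = deg P - deg Q ≤ 4`, each `m_i` in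
`{1, 2, 3, 4, 5, 6, 8, 10, 12}`.  (Degrees `57`, `58` recover `subLehmer_degree57_structure`,
`subLehmer_degree58_structure`; degrees `59`, `60` are the new cases: the height-1 census there is
`CORES(56) / CORES(58) / CORES(60)` plus the explicit offset families indexed by `(a, {m_i})`.) -/
theorem subLehmer_degree_le_60_structure (h : SubLehmerDegreeBound) (hS : NonreciprocalMahlerBound)
    {P : ℤ[X]} (hP : SubLehmer P) (hdeg : P.natDegree ≤ 60) :
    ∃ (u : ℤ) (a : ℕ) (s : Multiset ℕ) (Q : ℤ[X]), (u = 1 ∨ u = -1) ∧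
      (∀ m ∈ s, m ∈ ({1, 2, 3, 4, 5, 6, 8, 10, 12} : Finset ℕ)) ∧
      P = C u * X ^ a * (s.map fun m => cyclotomic m ℤ).prod * Q ∧ Irreducible Q ∧ SubLehmer Q ∧
      intMahlerMeasure Q = intMahlerMeasure P ∧ Q.reverse = Q ∧
      (Q.natDegree = 56 ∨ Q.natDegree = 58 ∨ Q.natDegree = 60) ∧
      Q.coeff 0 ≠ 0 ∧ (∀ n : ℕ, 0 < n → ¬ cyclotomic n ℤ ∣ Q) ∧
      a + (s.map Nat.totient).sum + Q.natDegree = P.natDegree ∧ a + (s.map Nat.totient).sum ≤ 4 := by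
  obtain ⟨u, a, s, Q, hu, hs, hPf, hQirr, hQ, hMQ, hrev, heven, hQ56, hc0, hncyc, hdegs⟩ :=
    subLehmer_structure h hS hP (by omega)
  have hcof : a + (s.map Nat.totient).sum ≤ 4 := by omega
  refine ⟨u, a, s, Q, hu, fun m hm => ?_, hPf, hQirr, hQ, hMQ, hrev, ?_, hc0, hncyc, hdegs, hcof⟩
  · -- φ(m) ≤ Σ φ ≤ 4
    have hle : Nat.totient m ≤ (s.map Nat.totient).sum :=
      Multiset.le_sum_of_mem (Multiset.mem_map_of_mem Nat.totient hm)
    exact Summit.KontsevichZagierPeriods.KzOnePeriods.LemmaN.totient_le_four (hs m hm) (by omega)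
  · have hQ60 : Q.natDegree ≤ 60 := by omega
    obtain ⟨k, hk⟩ := heven
    omega

end Summit.Ventures.DiscreteObjects.Mahler
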